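import Mathlib
import Summits.NavierStokesRegularity.NavierStokesRegularity.Theorems.ScenarioCensusPeriodicSlabCorrector
import Summits.NavierStokesRegularity.NavierStokesRegularity.Theorems.ScenarioCensusHelicalSlabTerms
import HarnessLib

/-!
# Census row S7 (c): the vertical period mean and the bound for the corrector pressure term

Support file for the scenario census of `NavierStokesRegularity` (cell `pub/ns-census`, block S,
row S7 = Bang–Gui–Wang–Xie, J. Fluid Mech. 1005 (2025) A6 = arXiv:2205.13259, Thm 1.4 (c)). In
the Saint-Venant estimate for case (c) (§5 Step 3) the cut-off pressure term `∫ P u^r φ'` is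
split along `u^r = (u^r − ū^r) + ū^r`, `ū^r` the vertical period mean; the mean-free part is
handled as in rows S6 / S7 (a)(b) (foot-point splitting), the mean part through the corrector
`Ψ = Φ̃ J∇φ` of `…PeriodicSlabCorrector` with `div Ψ = a ⟪x_h, g⟫`,
`g = ∫₀ᴸ U(· + s e₃) ds`:

* `verticalIntegral_props` — `g` is `C¹` with `Dg = ∫₀ᴸ DU(· + s e₃) ds` continuous,
  `‖g‖ ≤ M L`, `‖Dg‖ ≤ K₁ L`, horizontal trace of `Dg` zero (from `div U = 0`, `∂₃ g = 0`),
  `z`-invariant, and `⟪x_h, g x⟫ = ∫₀ᴸ ⟪x_h, U(x + s e₃)⟫ ds`;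
* `corrector_pressure_bound` — for a smooth bounded axially periodic steady flow at unit
  viscosity with `|⟪x_h, U⟫| ≤ ε ≤ 1` off the cylinder `{ρ < r}` (`r ≥ 1`):
  `|∫_S P a ⟪x_h, g⟫| ≤ L (a₃ λ r + c₃ (∫_S χ|DU|²)/(λ r))` for every `λ > 0`, with `a₃, c₃`
  depending only on `sup ‖U‖`, `L` and the cut-off constant — the printed (4-27)/(4-36)/(4-37)
  with `R u^r` bounded, here WITHOUT the Bogovskiĭ operator.

No summit statement and no census row is proved in this file.

## References

* J. Bang, C. Gui, Y. Wang, C. Xie, arXiv:2205.13259, §5 Step 3, (4-19)–(4-37).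
  [BangGuiWangXie2025]
-/

-- the summit and its single problem share the name (D-0017 nested layout)
set_option linter.dupNamespace false

noncomputable section

open MeasureTheory Set Function Filter InnerProductSpace
open scoped Topology ENNReal NNReal RealInnerProductSpace Laplacian ContDiff

namespace Summit.NavierStokesRegularity.NavierStokesRegularity.Theorems.ScenarioCensus.PeriodicSlab

open Literature.Analysis Literature.Analysis.FluidPDE
open Summit.NavierStokesRegularity.NavierStokesRegularity.Theorems.ScenarioCensus.HelicalSlab

/-! ### The vertical period mean `g = ∫₀ᴸ U(· + s e₃) ds` -/

/-- **The vertical period integral of a bounded divergence-free periodic field.** Let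
`U ∈ C¹(ℝ³; ℝ³)` with `‖U‖ ≤ M`, `‖DU‖ ≤ K₁`, `div U = 0`, axially `L`-periodic (`L > 0`), and
`g(y) = ∫₀ᴸ U(y + s e₃) ds`, `Dg(y) = ∫₀ᴸ DU(y + s e₃) ds`. Then `g` has derivative `Dg`
everywhere, `Dg` is continuous, `‖g‖ ≤ M L`, `‖Dg‖ ≤ K₁ L`, the horizontal trace of `Dg`
vanishes, `g` is invariant under axial translations, and `⟪x_h, g x⟫ = ∫₀ᴸ ⟪x_h, U(x + s e₃)⟫ ds`. -/
theorem verticalIntegral_props {L M K₁ : ℝ} (hL : 0 < L)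
    {U : EuclideanSpace ℝ (Fin 3) → EuclideanSpace ℝ (Fin 3)} (hU : ContDiff ℝ 1 U)
    (hM : ∀ x, ‖U x‖ ≤ M) (hK₁ : ∀ x, ‖fderiv ℝ U x‖ ≤ K₁) (hdiv : VectorCalculus.IsDivFree U)
    (hper : IsAxiallyPeriodic L U) :
    (∀ y, HasFDerivAt (fun y => ∫ s in (0 : ℝ)..L, U (y + s • eZ))
        (∫ s in (0 : ℝ)..L, fderiv ℝ U (y + s • eZ)) y) ∧
      (Continuous fun y => ∫ s in (0 : ℝ)..L, fderiv ℝ U (y + s • eZ)) ∧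
      (∀ y, ‖∫ s in (0 : ℝ)..L, U (y + s • eZ)‖ ≤ M * L) ∧
      (∀ y, ‖∫ s in (0 : ℝ)..L, fderiv ℝ U (y + s • eZ)‖ ≤ K₁ * L) ∧
      (∀ y, (∫ s in (0 : ℝ)..L, fderiv ℝ U (y + s • eZ)) (EuclideanSpace.single 0 1) 0 +
          (∫ s in (0 : ℝ)..L, fderiv ℝ U (y + s • eZ)) (EuclideanSpace.single 1 1) 1 = 0) ∧
      (∀ (y : EuclideanSpace ℝ (Fin 3)) (t : ℝ),
          (∫ s in (0 : ℝ)..L, U (y + t • eZ + s • eZ)) = ∫ s in (0 : ℝ)..L, U (y + s • eZ)) ∧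
      ∀ y, ⟪horizPart y, ∫ s in (0 : ℝ)..L, U (y + s • eZ)⟫ =
          ∫ s in (0 : ℝ)..L, ⟪horizPart y, U (y + s • eZ)⟫ := by
  have hUc : Continuous U := hU.continuous
  have hDUc : Continuous (fderiv ℝ U) := hU.continuous_fderiv one_ne_zero
  have hline : ∀ y : EuclideanSpace ℝ (Fin 3), Continuous fun s : ℝ => y + s • (eZ : EuclideanSpace ℝ (Fin 3)) :=
    fun y => continuous_const.add (continuous_id.smul continuous_const)
  set g : EuclideanSpace ℝ (Fin 3) → EuclideanSpace ℝ (Fin 3) := fun y => ∫ s in (0 : ℝ)..L, U (y + s • eZ)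
    with hg
  set Dg : EuclideanSpace ℝ (Fin 3) → (EuclideanSpace ℝ (Fin 3) →L[ℝ] EuclideanSpace ℝ (Fin 3)) :=
    fun y => ∫ s in (0 : ℝ)..L, fderiv ℝ U (y + s • eZ) with hDg
  have hgD : ∀ y, HasFDerivAt g (Dg y) y := fun y => hasFDerivAt_verticalIntegral hU hK₁ y
  have hgd : Differentiable ℝ g := fun y => (hgD y).differentiableAt
  have hgF : ∀ y, fderiv ℝ g y = Dg y := fun y => (hgD y).fderiv
  have hDint : ∀ y, IntervalIntegrable (fun s : ℝ => fderiv ℝ U (y + s • eZ)) volume 0 L :=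
    fun y => (hDUc.comp (hline y)).intervalIntegrable _ _
  have hDgc : Continuous Dg := by
    have h := intervalIntegral.continuous_parametric_intervalIntegral_of_continuous'
      (μ := volume) (f := fun (y : EuclideanSpace ℝ (Fin 3)) (s : ℝ) => fderiv ℝ U (y + s • eZ))
      (by exact hDUc.comp (continuous_fst.add (continuous_snd.smul continuous_const))) 0 L
    exact h
  have hgz : ∀ (y : EuclideanSpace ℝ (Fin 3)) (t : ℝ), g (y + t • eZ) = g y :=
    fun y t => verticalIntegral_add_smul_eZ hper y t
  -- norms
  have hG₀ : ∀ y, ‖g y‖ ≤ M * L := fun y => by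
    have h := intervalIntegral.norm_integral_le_of_norm_le_const (a := 0) (b := L)
      (f := fun s : ℝ => U (y + s • eZ)) (C := M) fun s _ => hM _
    rwa [sub_zero, abs_of_pos hL] at h
  have hK : ∀ y, ‖Dg y‖ ≤ K₁ * L := fun y => by
    have h := intervalIntegral.norm_integral_le_of_norm_le_const (a := 0) (b := L)
      (f := fun s : ℝ => fderiv ℝ U (y + s • eZ)) (C := K₁) fun s _ => hK₁ _
    rwa [sub_zero, abs_of_pos hL] at h
  -- divergence and the axial column
  set τ : (EuclideanSpace ℝ (Fin 3) →L[ℝ] EuclideanSpace ℝ (Fin 3)) →L[ℝ] ℝ :=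
    LinearMap.toContinuousLinearMap
      ((LinearMap.trace ℝ (EuclideanSpace ℝ (Fin 3))).comp (ContinuousLinearMap.coeLM ℝ)) with hτ
  have hτ_apply : ∀ T : EuclideanSpace ℝ (Fin 3) →L[ℝ] EuclideanSpace ℝ (Fin 3),
      τ T = LinearMap.trace ℝ _ (T : EuclideanSpace ℝ (Fin 3) →ₗ[ℝ] EuclideanSpace ℝ (Fin 3)) :=
    fun T => rfl
  have hdivg : ∀ y, VectorCalculus.divergence g y = 0 := fun y => by
    rw [VectorCalculus.divergence, hgF y, ← hτ_apply, hDg, ← τ.intervalIntegral_comp_comm (hDint y)]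
    have : (fun s : ℝ => τ (fderiv ℝ U (y + s • eZ))) = fun _ => (0 : ℝ) := by
      funext s
      rw [hτ_apply]
      exact hdiv (y + s • eZ)
    rw [this, intervalIntegral.integral_const, smul_zero]
  have hDg_eZ : ∀ y, fderiv ℝ g y eZ = 0 := fun y => by
    have h1 : HasDerivAt (fun t : ℝ => g (y + t • eZ)) (fderiv ℝ g (y + (0 : ℝ) • eZ) eZ) 0 :=
      hasDerivAt_comp_add_smul_eZ hgd y 0
    have h2 : (fun t : ℝ => g (y + t • eZ)) = fun _ => g y := funext fun t => hgz y t
    rw [h2, zero_smul, add_zero] at h1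
    exact h1.unique (hasDerivAt_const (0 : ℝ) (g y))
  set b := EuclideanSpace.basisFun (Fin 3) ℝ with hb
  have htr : ∀ y, Dg y (EuclideanSpace.single 0 1) 0 + Dg y (EuclideanSpace.single 1 1) 1 = 0 := by
    intro y
    have hb0 : b 0 = EuclideanSpace.single 0 (1 : ℝ) := by simp [hb]
    have hb1 : b 1 = EuclideanSpace.single 1 (1 : ℝ) := by simp [hb]
    have hb2 : b 2 = EuclideanSpace.single 2 (1 : ℝ) := by simp [hb]
    have htr3 : ⟪b 0, Dg y (b 0)⟫ + ⟪b 1, Dg y (b 1)⟫ + ⟪b 2, Dg y (b 2)⟫ = 0 := by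
      have h := divergence_eq_sum_inner_fderiv b g y
      rw [hdivg y, Fin.sum_univ_three, hgF y] at h
      linarith
    have hcol : Dg y (b 2) = 0 := by rw [hb2, ← hgF y]; exact hDg_eZ y
    rw [hcol, inner_zero_right, add_zero, hb0, hb1] at htr3
    simpa [EuclideanSpace.inner_single_left] using htr3
  have hrepr : ∀ y, ⟪horizPart y, g y⟫ = ∫ s in (0 : ℝ)..L, ⟪horizPart y, U (y + s • eZ)⟫ := by
    intro y
    show innerSL ℝ (horizPart y) (∫ s in (0 : ℝ)..L, U (y + s • eZ)) = _
    have hint : IntervalIntegrable (fun s : ℝ => U (y + s • eZ)) volume 0 L :=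
      (hUc.comp (hline y)).intervalIntegrable _ _
    rw [← (innerSL ℝ (horizPart y)).intervalIntegral_comp_comm hint]
    simp only [innerSL_apply_apply]
  exact ⟨hgD, hDgc, hG₀, hK, htr, hgz, hrepr⟩

/-! ### The corrector pressure term -/

/-- Young: `y ≤ (μ + y²/μ)/2` for `μ > 0` (local copy of the elementary step). -/
theorem young_le_half (y : ℝ) {μ : ℝ} (hμ : 0 < μ) : y ≤ (μ + y ^ 2 / μ) / 2 :=
  (le_abs_self y).trans (young_abs_le y hμ)

/-- **The corrector pressure term is of Saint-Venant size.** Let `(U, P)` be a smooth steady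
solution at unit viscosity (`IsLerayProfile 1 0 U P`, `U, P ∈ C^∞`), both axially `L`-periodic
(`L > 0`), with `‖U‖ ≤ M`, `‖DU‖ ≤ K₁`, `|DU|² ≤ B`; let `r ≥ 1`, `χ = 𝟙{r ≤ ρ < 2r}`, and let
`C ≥ 0` bound the dyadic cut-off coefficient and rotation field as in `exists_corrField_bounds`.
If `|⟪x_h, U x⟫| ≤ ε` for all `x` with `ρ(x) ≥ r`, `ε ≤ 1`, then for every `λ > 0`, with
`g = ∫₀ᴸ U(· + s e₃) ds` and `D = ∫_S χ |DU|²` (`S = zSlab L 0`):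
`|∫_S P a ⟪x_h, g⟫| ≤ L ((48 C L (3M + π) + 16 C L M (π + M)) λ r + ((3/2) C (3M + π) + (1/2) C M (π + M)) D/(λ r))`. -/
theorem corrector_pressure_bound {L M K₁ B C r lam ε : ℝ} (hL : 0 < L)
    {U : EuclideanSpace ℝ (Fin 3) → EuclideanSpace ℝ (Fin 3)} {P : EuclideanSpace ℝ (Fin 3) → ℝ}
    (h : IsLerayProfile 1 0 U P) (hU : ContDiff ℝ (⊤ : ℕ∞) U) (hP : ContDiff ℝ (⊤ : ℕ∞) P)
    (hUper : IsAxiallyPeriodic L U) (hPper : IsAxiallyPeriodic L P)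
    (hM : ∀ x, ‖U x‖ ≤ M) (hK₁ : ∀ x, ‖fderiv ℝ U x‖ ≤ K₁)
    (hB : ∀ x, frobeniusNormSq (fderiv ℝ U x) ≤ B) (hC0 : 0 ≤ C)
    (hW : ∀ x, ‖corrField r x‖ ≤
      C / r * {x | r ≤ cylRadius x ∧ cylRadius x < 2 * r}.indicator (fun _ => (1 : ℝ)) x)
    (hDW : ∀ x, ‖fderiv ℝ (corrField r) x‖ ≤
      C / r ^ 2 * {x | r ≤ cylRadius x ∧ cylRadius x < 2 * r}.indicator (fun _ => (1 : ℝ)) x)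
    (hr : 1 ≤ r) (hlam : 0 < lam) (hε1 : ε ≤ 1)
    (hdec : ∀ x, r ≤ cylRadius x → |⟪horizPart x, U x⟫| ≤ ε) :
    |∫ x in zSlab L 0, P x * (dyCoeff r x * ⟪horizPart x, ∫ s in (0 : ℝ)..L, U (x + s • eZ)⟫)| ≤
      L * ((48 * C * L * (3 * M + Real.pi) + 16 * C * L * M * (Real.pi + M)) * lam * r +
        (3 / 2 * C * (3 * M + Real.pi) + 1 / 2 * C * M * (Real.pi + M)) *
          (∫ x in zSlab L 0,
            {x | r ≤ cylRadius x ∧ cylRadius x < 2 * r}.indicator (fun _ => (1 : ℝ)) x *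
              frobeniusNormSq (fderiv ℝ U x)) / (lam * r)) := by
  set b := EuclideanSpace.basisFun (Fin 3) ℝ with hb
  set S : Set (EuclideanSpace ℝ (Fin 3)) := zSlab L 0 with hS
  set F : EuclideanSpace ℝ (Fin 3) → ℝ := fun x => frobeniusNormSq (fderiv ℝ U x) with hF
  set A : Set (EuclideanSpace ℝ (Fin 3)) := {x | r ≤ cylRadius x ∧ cylRadius x < 2 * r} with hA
  set χ : EuclideanSpace ℝ (Fin 3) → ℝ := A.indicator fun _ => (1 : ℝ) with hχ
  have hr0 : 0 < r := by linarith
  have hM0 : 0 ≤ M := (norm_nonneg _).trans (hM 0)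
  have hU1 : ContDiff ℝ 1 U := contDiff_infty.1 hU 1
  have hU2 : ContDiff ℝ 2 U := contDiff_infty.1 hU 2
  have hP1 : ContDiff ℝ 1 P := contDiff_infty.1 hP 1
  have hUc : Continuous U := hU1.continuous
  have hDUc : Continuous (fderiv ℝ U) := hU1.continuous_fderiv one_ne_zero
  have hFc : Continuous F := continuous_frobeniusNormSq_fderiv hU1 one_ne_zero
  have hF0 : ∀ x, 0 ≤ F x := fun x => frobeniusNormSq_nonneg _
  have hdi : ∀ x i, ‖fderiv ℝ U x (b i)‖ ^ 2 ≤ F x := fun x i => norm_apply_sq_le_frobeniusNormSq b _ i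
  have hop : ∀ x, ‖fderiv ℝ U x‖ ^ 2 ≤ F x := fun x => sq_opNorm_le_frobeniusNormSq _
  have hAm : MeasurableSet A :=
    (isClosed_le continuous_const continuous_cylRadius).measurableSet.inter
      (isOpen_lt continuous_cylRadius continuous_const).measurableSet
  have hχm : Measurable χ := measurable_const.indicator hAm
  have hχnn : ∀ x, 0 ≤ χ x := fun x => Set.indicator_nonneg (fun _ _ => zero_le_one) x
  have hχle : ∀ x, χ x ≤ 1 := fun x => Set.indicator_le_self' (fun _ _ => zero_le_one) x
  have hχzero : ∀ x, 2 * r ≤ cylRadius x → χ x = 0 := fun x hx => by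
    simp only [hχ, Set.indicator_apply, hA, mem_setOf_eq]
    rw [if_neg]; exact fun h' => absurd h'.2 (not_lt.2 hx)
  have hχA : ∀ x, x ∈ A → χ x = 1 := fun x hx => by simp [hχ, hx]
  have hχA' : ∀ x, x ∉ A → χ x = 0 := fun x hx => by simp [hχ, hx]
  -- the vertical period mean
  obtain ⟨hgD, hDgc, hG₀, hK, htr, hgz, hrepr⟩ := verticalIntegral_props hL hU1 hM hK₁ h.divFree hUper
  set g : EuclideanSpace ℝ (Fin 3) → EuclideanSpace ℝ (Fin 3) := fun y => ∫ s in (0 : ℝ)..L, U (y + s • eZ)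
    with hgdef
  have hgh : ∀ x, g (horizPart x) = g x := fun x => by
    have e : horizPart x = x + (-(x 2)) • eZ := by
      rw [horizPart_apply, sub_eq_add_neg, neg_smul]
    rw [e]; exact hgz x _
  -- the radial flux of `g` is small off the cylinder `{ρ < r}`
  have hflux : ∀ y, r ≤ cylRadius y → |⟪horizPart y, g y⟫| ≤ L * ε := by
    intro y hy
    rw [hrepr y]
    have h1 := intervalIntegral.norm_integral_le_of_norm_le_const (a := 0) (b := L)
      (f := fun s : ℝ => ⟪horizPart y, U (y + s • eZ)⟫) (C := ε) fun s _ => by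
        rw [Real.norm_eq_abs, ← horizPart_add_smul_eZ y s]
        refine hdec _ ?_
        have : cylRadius (y + s • eZ) = cylRadius y := by simp [cylRadius, eZ]
        rw [this]; exact hy
    rw [sub_zero, abs_of_pos hL, Real.norm_eq_abs] at h1
    linarith
  -- the corrector potential on the annulus: `|Φ̃| ≤ π L ε + M L ≤ L (π + M)`
  have hΦA : ∀ x, x ∈ A → |streamCorrector g x| ≤ L * (Real.pi + M) := by
    intro x hx
    have hx0 : 0 < cylRadius x := lt_of_lt_of_le hr0 hx.1
    have h1 := abs_streamCorrector_le hgD hDgc hG₀ hK htr hx0 (N := L * ε) fun y _ hy =>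
      hflux y (by rw [hy]; exact hx.1)
    have h2 : Real.pi * (L * ε) ≤ Real.pi * L := by
      have : L * ε ≤ L * 1 := mul_le_mul_of_nonneg_left hε1 hL.le
      rw [mul_one] at this
      exact mul_le_mul_of_nonneg_left this Real.pi_pos.le
    calc |streamCorrector g x| ≤ Real.pi * (L * ε) + M * L := h1
      _ ≤ L * (Real.pi + M) := by nlinarith
  -- the corrector field and its bounds
  obtain ⟨hΨ1, hdivΨ, hΨb, hDΨb⟩ := streamCorrectorField_props hgD hDgc hG₀ hK htr hr0 hC0 hW hDW
  set Ψ := streamCorrectorField g r with hΨdef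
  have hΨn : ∀ x, ‖Ψ x‖ ≤ L * (Real.pi + M) * C / r * χ x := by
    intro x
    by_cases hx : x ∈ A
    · have h1 := hΨb x
      rw [← hχ] at h1
      rw [hχA x hx, mul_one] at h1 ⊢
      calc ‖Ψ x‖ ≤ |streamCorrector g x| * (C / r) := h1
        _ ≤ L * (Real.pi + M) * (C / r) := mul_le_mul_of_nonneg_right (hΦA x hx) (by positivity)
        _ = L * (Real.pi + M) * C / r := by ring
    · have h1 := hΨb x
      rw [← hχ] at h1
      rw [hχA' x hx, mul_zero] at h1 ⊢
      exact h1
  have hDΨn : ∀ x, ‖fderiv ℝ Ψ x‖ ≤ L * C * (3 * M + Real.pi) / r * χ x := by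
    intro x
    by_cases hx : x ∈ A
    · have h1 := hDΨb x
      rw [← hχ] at h1
      rw [hχA x hx, mul_one] at h1 ⊢
      have h2 : |streamCorrector g x| * (C / r ^ 2) ≤ L * (Real.pi + M) * (C / r) := by
        have h3 : C / r ^ 2 ≤ C / r := by
          rw [div_le_div_iff₀ (by positivity) hr0]
          calc C * r = C * r * 1 := by ring
            _ ≤ C * r * r := mul_le_mul_of_nonneg_left hr (by positivity)
            _ = C * r ^ 2 := by ring
        exact mul_le_mul (hΦA x hx) h3 (by positivity) (by positivity)
      calc ‖fderiv ℝ Ψ x‖ ≤ 2 * (M * L) * (C / r) + |streamCorrector g x| * (C / r ^ 2) := h1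
        _ ≤ 2 * (M * L) * (C / r) + L * (Real.pi + M) * (C / r) := by linarith
        _ = L * C * (3 * M + Real.pi) / r := by ring
    · have h1 := hDΨb x
      rw [← hχ] at h1
      rw [hχA' x hx, mul_zero] at h1 ⊢
      exact h1
  have hΨ0 : ∀ x, 2 * r ≤ cylRadius x → Ψ x = 0 := fun x hx => by
    have h1 := hΨn x
    rw [hχzero x hx, mul_zero] at h1
    exact norm_eq_zero.1 (le_antisymm h1 (norm_nonneg _))
  have hDΨ0 : ∀ x, 2 * r ≤ cylRadius x → fderiv ℝ Ψ x = 0 := fun x hx => by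
    have h1 := hDΨn x
    rw [hχzero x hx, mul_zero] at h1
    exact norm_eq_zero.1 (le_antisymm h1 (norm_nonneg _))
  have hΨper : IsAxiallyPeriodic L Ψ := fun x => streamCorrectorField_add_smul_eZ g r x L
  -- the momentum equation at unit viscosity
  have hNS : ∀ x, convect U U x = (Δ U) x - gradient P x := fun x => by
    have e := h.profile_eq x
    simp only [one_smul, zero_smul, add_zero] at e
    rw [← sub_eq_zero]
    rw [← e]
    abel
  -- the corrector identity
  have hid := corrector_identity hL hU2 hP1 hΨ1 hNS hUper hPper hΨper hΨ0 hDΨ0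
  have hJ : ∫ x in S, P x * (dyCoeff r x * ⟪horizPart x, g x⟫) =
      ∫ x in S, P x * VectorCalculus.divergence Ψ x := by
    refine setIntegral_congr_fun (measurableSet_zSlab L 0) fun x _ => ?_
    rw [hdivΨ x, hgh x]
  -- integrability of the dominating functions
  have hχ_int : IntegrableOn χ S volume :=
    integrableOn_zSlab_of_bound hL hχm.aestronglyMeasurable (ρ := 2 * r) hχzero (B := 1)
      fun x _ => by rw [Real.norm_eq_abs, abs_of_nonneg (hχnn x)]; exact hχle x
  have hB0 : 0 ≤ B := (hF0 0).trans (hB 0)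
  have hD_int : IntegrableOn (fun x => χ x * F x) S volume := by
    refine integrableOn_zSlab_of_bound hL ((hχm.mul hFc.measurable).aestronglyMeasurable)
      (ρ := 2 * r) (fun x hx => by rw [hχzero x hx, zero_mul]) (B := B) fun x _ => ?_
    rw [Real.norm_eq_abs, abs_mul, abs_of_nonneg (hχnn x), abs_of_nonneg (hF0 x)]
    exact (mul_le_mul (hχle x) (hB x) (hF0 x) zero_le_one).trans (by rw [one_mul])
  set V : ℝ := ∫ x in S, χ x with hVdef
  set D : ℝ := ∫ x in S, χ x * F x with hD
  have hD0 : 0 ≤ D := setIntegral_nonneg (measurableSet_zSlab L 0) fun x _ => mul_nonneg (hχnn x) (hF0 x)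
  have hV : V ≤ 32 * L * r ^ 2 := by
    have h1 : V = volume.real (S ∩ A) := by
      rw [hVdef, hχ, setIntegral_indicator hAm, setIntegral_const, smul_eq_mul, mul_one]
    rw [h1, measureReal_def]
    refine ENNReal.toReal_le_of_le_ofReal (by positivity) ?_
    calc volume (S ∩ A) ≤ volume (zSlab L 0 ∩ {x | cylRadius x < 2 * r}) :=
          measure_mono fun x hx => ⟨hx.1, hx.2.2⟩
      _ ≤ ENNReal.ofReal (8 * L * (2 * r) ^ 2) := volume_zSlab_inter_cyl_le hL (by linarith)
      _ = ENNReal.ofReal (32 * L * r ^ 2) := by ring_nf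
  -- the generic `χ`-weighted bound: `|q| ≤ (c/r) χ ‖DU‖-type` ⇒ `|∫ q| ≤ 16 c L λ r + c D/(2 λ r)`
  have hgen : ∀ c : ℝ, 0 ≤ c → ∀ q : EuclideanSpace ℝ (Fin 3) → ℝ, IntegrableOn q S volume →
      ∀ n : EuclideanSpace ℝ (Fin 3) → ℝ, (∀ x, 0 ≤ n x) → (∀ x, n x ^ 2 ≤ F x) →
      (∀ x, |q x| ≤ c / r * χ x * n x) →
      |∫ x in S, q x| ≤ 16 * c * L * lam * r + c / 2 * D / (lam * r) := by
    intro c hc q hqi n hn0 hnF hqb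
    have hdom_int : IntegrableOn (fun x => c * lam / (2 * r) * χ x + c / (2 * r * lam) * (χ x * F x)) S volume :=
      (hχ_int.const_mul _).add (hD_int.const_mul _)
    have h1 := norm_integral_le_of_norm_le (μ := volume.restrict S) hdom_int
      (Eventually.of_forall fun x => (?_ :
        ‖q x‖ ≤ c * lam / (2 * r) * χ x + c / (2 * r * lam) * (χ x * F x)))
    · rw [Real.norm_eq_abs] at h1
      have h2 : ∫ x in S, (c * lam / (2 * r) * χ x + c / (2 * r * lam) * (χ x * F x)) =
          c * lam / (2 * r) * V + c / (2 * r * lam) * D := by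
        rw [integral_add (hχ_int.const_mul _) (hD_int.const_mul _), integral_const_mul, integral_const_mul]
      rw [h2] at h1
      have h3 : c * lam / (2 * r) * V ≤ c * lam / (2 * r) * (32 * L * r ^ 2) :=
        mul_le_mul_of_nonneg_left hV (by positivity)
      have e : c * lam / (2 * r) * (32 * L * r ^ 2) + c / (2 * r * lam) * D =
          16 * c * L * lam * r + c / 2 * D / (lam * r) := by
        field_simp
        ring
      linarith
    · rw [Real.norm_eq_abs]
      have hy := young_le_half (n x) hlam
      have hy' : n x ≤ (lam + F x / lam) / 2 :=
        hy.trans (by have := div_le_div_of_nonneg_right (hnF x) hlam.le; linarith)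
      have h5 : 0 ≤ c / r * χ x := mul_nonneg (div_nonneg hc hr0.le) (hχnn x)
      calc |q x| ≤ c / r * χ x * n x := hqb x
        _ ≤ c / r * χ x * ((lam + F x / lam) / 2) := mul_le_mul_of_nonneg_left hy' h5
        _ = c * lam / (2 * r) * χ x + c / (2 * r * lam) * (χ x * F x) := by
            field_simp
  -- the Green–corrector terms
  have hGreen : ∀ i, |∫ x in S, ⟪fderiv ℝ U x (b i), fderiv ℝ Ψ x (b i)⟫| ≤
      16 * (L * C * (3 * M + Real.pi)) * L * lam * r + (L * C * (3 * M + Real.pi)) / 2 * D / (lam * r) := by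
    intro i
    have hbi : ‖b i‖ = 1 := b.orthonormal.1 i
    have hqi : IntegrableOn (fun x => ⟪fderiv ℝ U x (b i), fderiv ℝ Ψ x (b i)⟫) S volume :=
      integrableOn_zSlab_of_eq_zero_of_le_cylRadius (Q := fun x => ⟪fderiv ℝ U x (b i), fderiv ℝ Ψ x (b i)⟫)
        ((hDUc.clm_apply continuous_const).inner ((hΨ1.continuous_fderiv one_ne_zero).clm_apply continuous_const))
        (fun x hx => by show ⟪fderiv ℝ U x (b i), fderiv ℝ Ψ x (b i)⟫ = 0; rw [hDΨ0 x hx]; simp) L 0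
    refine hgen _ (by positivity) _ hqi (fun x => ‖fderiv ℝ U x (b i)‖) (fun x => norm_nonneg _)
      (fun x => hdi x i) fun x => ?_
    calc |⟪fderiv ℝ U x (b i), fderiv ℝ Ψ x (b i)⟫| ≤ ‖fderiv ℝ U x (b i)‖ * ‖fderiv ℝ Ψ x (b i)‖ :=
          abs_real_inner_le_norm _ _
      _ ≤ ‖fderiv ℝ U x (b i)‖ * (L * C * (3 * M + Real.pi) / r * χ x) := by
          refine mul_le_mul_of_nonneg_left ?_ (norm_nonneg _)
          calc ‖fderiv ℝ Ψ x (b i)‖ ≤ ‖fderiv ℝ Ψ x‖ * ‖b i‖ := ContinuousLinearMap.le_opNorm _ _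
            _ ≤ L * C * (3 * M + Real.pi) / r * χ x := by rw [hbi, mul_one]; exact hDΨn x
      _ = L * C * (3 * M + Real.pi) / r * χ x * ‖fderiv ℝ U x (b i)‖ := by ring
  have hGreenS : |∑ i, ∫ x in S, ⟪fderiv ℝ U x (b i), fderiv ℝ Ψ x (b i)⟫| ≤
      3 * (16 * (L * C * (3 * M + Real.pi)) * L * lam * r) +
        3 * ((L * C * (3 * M + Real.pi)) / 2 * D / (lam * r)) := by
    refine (Finset.abs_sum_le_sum_abs _ _).trans ?_
    calc ∑ i, |∫ x in S, ⟪fderiv ℝ U x (b i), fderiv ℝ Ψ x (b i)⟫|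
        ≤ ∑ _i : Fin 3, (16 * (L * C * (3 * M + Real.pi)) * L * lam * r +
            (L * C * (3 * M + Real.pi)) / 2 * D / (lam * r)) := Finset.sum_le_sum fun i _ => hGreen i
      _ = _ := by simp
  -- the convective corrector term
  have hConv : |∫ x in S, ⟪convect U U x, Ψ x⟫| ≤
      16 * (M * (L * (Real.pi + M) * C)) * L * lam * r + (M * (L * (Real.pi + M) * C)) / 2 * D / (lam * r) := by
    have hqi : IntegrableOn (fun x => ⟪convect U U x, Ψ x⟫) S volume :=
      integrableOn_zSlab_of_eq_zero_of_le_cylRadius (Q := fun x => ⟪convect U U x, Ψ x⟫)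
        ((hDUc.clm_apply hUc).inner hΨ1.continuous)
        (fun x hx => by show ⟪convect U U x, Ψ x⟫ = 0; rw [hΨ0 x hx, inner_zero_right]) L 0
    refine hgen _ (by positivity) _ hqi (fun x => ‖fderiv ℝ U x‖) (fun x => norm_nonneg _) hop fun x => ?_
    rw [convect_apply]
    calc |⟪fderiv ℝ U x (U x), Ψ x⟫| ≤ ‖fderiv ℝ U x (U x)‖ * ‖Ψ x‖ := abs_real_inner_le_norm _ _
      _ ≤ (‖fderiv ℝ U x‖ * M) * (L * (Real.pi + M) * C / r * χ x) :=
          mul_le_mul ((ContinuousLinearMap.le_opNorm _ _).trans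
            (mul_le_mul_of_nonneg_left (hM x) (norm_nonneg _))) (hΨn x) (norm_nonneg _) (by positivity)
      _ = M * (L * (Real.pi + M) * C) / r * χ x * ‖fderiv ℝ U x‖ := by ring
  -- assemble
  rw [hJ, hid]
  have hsum := (abs_add_le _ _).trans (add_le_add hGreenS hConv)
  have e : 3 * (16 * (L * C * (3 * M + Real.pi)) * L * lam * r) +
        3 * ((L * C * (3 * M + Real.pi)) / 2 * D / (lam * r)) +
      (16 * (M * (L * (Real.pi + M) * C)) * L * lam * r + (M * (L * (Real.pi + M) * C)) / 2 * D / (lam * r)) =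
      L * ((48 * C * L * (3 * M + Real.pi) + 16 * C * L * M * (Real.pi + M)) * lam * r +
        (3 / 2 * C * (3 * M + Real.pi) + 1 / 2 * C * M * (Real.pi + M)) * D / (lam * r)) := by
    ring
  exact hsum.trans_eq e

end Summit.NavierStokesRegularity.NavierStokesRegularity.Theorems.ScenarioCensus.PeriodicSlab

end
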